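import Summits.AtomisticToContinuum.Crystallization.Theorems.ExcessDecayLiouvilleHcpLiouvilleBlowdownKernelDiff
import Summits.AtomisticToContinuum.Crystallization.Theorems.ExcessDecayLiouvilleHcpLiouvilleBlowdownLocalise

/-!
# `ExcessDecayLiouville.HcpLiouville` (stmt-AtomisticToContinuum-9332), line `Sketch` (skeleton v4): far-field forcing bounds

Helper for stub `stub_interior` (steps (2)–(3) of the interior estimate for `L`-harmonic fields): the rows of the
localised field `ẑ = 𝟙_{B_{4R/5}(c)}(z − m)` are the far field `T(y) = Σ'_{q ∉ B_{4R/5}} K(y − q)(z q − m)`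
(…BlowdownLocalise), and its lattice differences fall on the kernel, whose differences decay (…BlowdownKernelDiff:
`|K| ≲ r⁻⁸`, `|ΔK| ≲ r⁻⁹`, `|Δ²K| ≲ r⁻¹⁰`).  With the far part of `z − m` split as `a + b`, `|a| ≤ Y₀`, `Σ|b|² ≤ Y₂²`,
the far sums over the `23/25`-separated sites at distance `≥ 3R/10` from `y ∈ B_{R/2}(c)` (`LevelOne.tsum_far_le`,
Cauchy–Schwarz for the `b`-part, `Blowdown.tsum_mul_le_sqrt_mul_sqrt`) give (`Blowdown.norm_farSum_sq_le`):
`‖T(y)‖² ≤ 10¹⁵(Y₀²R⁻¹⁰ + Y₂²R⁻¹³)`, `‖Δ_{Al}T(y)‖² ≤ 10²⁵(Y₀²R⁻¹² + Y₂²R⁻¹⁵)`,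
`‖Δ_{Al}Δ_{Al′}T(y)‖² ≤ 10³¹(Y₀²R⁻¹⁴ + Y₂²R⁻¹⁷)` (`Blowdown.farField_sq_le₀/₁/₂`; registered carrier `blowdown_forcing`).
All `[folklore]`; a `--supports` helper for item stmt-AtomisticToContinuum-9332, nothing here closes an item.
-/

noncomputable section

namespace Summit.AtomisticToContinuum.Crystallization.Theorems.ExcessDecayLiouville

open scoped BigOperators Topology Classical InnerProductSpace RealInnerProductSpace
open Literature.MathematicalPhysics.StatisticalMechanics
open Summit.AtomisticToContinuum.Crystallization.Theses.ExcessDecayLiouville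
open Summit.AtomisticToContinuum.Crystallization.Theorems.PhononStabilityNegative

namespace Blowdown

open LevelOne

variable {t : Fin 2 → (EuclideanSpace ℝ (Fin 3))}
  {A : (EuclideanSpace ℝ (Fin 3)) →L[ℝ] (EuclideanSpace ℝ (Fin 3))}

/-! ## Analysis lemmas -/

/-- **Discrete Cauchy–Schwarz** for square-summable nonnegative families:
`Σ' uᵢ vᵢ ≤ (Σ' uᵢ²)^{1/2} (Σ' vᵢ²)^{1/2}` (and the left side is summable). [folklore] -/
theorem tsum_mul_le_sqrt_mul_sqrt {ι : Type*} {u v : ι → ℝ} (hu0 : ∀ i, 0 ≤ u i) (hv0 : ∀ i, 0 ≤ v i)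
    (hu : Summable fun i => u i ^ 2) (hv : Summable fun i => v i ^ 2) :
    Summable (fun i => u i * v i) ∧
      ∑' i, u i * v i ≤ Real.sqrt (∑' i, u i ^ 2) * Real.sqrt (∑' i, v i ^ 2) := by
  have hs : Summable fun i => u i * v i := by
    refine Summable.of_nonneg_of_le (fun i => mul_nonneg (hu0 i) (hv0 i)) (fun i => ?_)
      ((hu.add hv).div_const 2)
    nlinarith [sq_nonneg (u i - v i)]
  refine ⟨hs, hs.tsum_le_of_sum_le fun s => ?_⟩
  calc ∑ i ∈ s, u i * v i ≤ √(∑ i ∈ s, u i ^ 2) * √(∑ i ∈ s, v i ^ 2) :=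
        Real.sum_mul_le_sqrt_mul_sqrt s u v
    _ ≤ √(∑' i, u i ^ 2) * √(∑' i, v i ^ 2) := by
        gcongr
        · exact hu.sum_le_tsum s fun i _ => sq_nonneg _
        · exact hv.sum_le_tsum s fun i _ => sq_nonneg _

/-- The far-field constants: `1024/((23/25)³(3R/10)ᵏ) ≤ c·R⁻ᵏ` once `1024(25/23)³(10/3)ᵏ ≤ c`. [folklore] -/
theorem far_const_le {R : ℝ} (hR : 0 < R) (k : ℕ) {c : ℝ} (hc : 1024 * (25 / 23 : ℝ) ^ 3 * (10 / 3 : ℝ) ^ k ≤ c) :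
    1024 / ((23 / 25 : ℝ) ^ 3 * (3 * R / 10) ^ k) ≤ c * (R⁻¹) ^ k := by
  have h : 1024 / ((23 / 25 : ℝ) ^ 3 * (3 * R / 10) ^ k) = 1024 * (25 / 23 : ℝ) ^ 3 * (10 / 3 : ℝ) ^ k * (R⁻¹) ^ k := by
    rw [show (3 * R / 10 : ℝ) = (3 / 10) * R by ring, mul_pow, inv_pow]
    field_simp
    rw [← mul_pow]; norm_num
  rw [h]
  exact mul_le_mul_of_nonneg_right hc (by positivity)

/-- Sites outside `B_{4R/5}(c)` are at distance `≥ 3R/10` from the points of `B_{R/2}(c)`. [folklore] -/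
theorem dist_far_ge {y q c : EuclideanSpace ℝ (Fin 3)} {R : ℝ} (hy : dist y c ≤ R / 2) (hq : ¬ dist q c ≤ 4 * R / 5) :
    3 * R / 10 ≤ dist q y := by
  have := dist_triangle q y c
  have hq' := not_le.1 hq
  linarith

/-- Uniform bound of the far part: `‖z q − m‖ ≤ Y₀ + Y₂` on the sites. [folklore] -/
theorem norm_sub_le_Ybar {z b : EuclideanSpace ℝ (Fin 3) → EuclideanSpace ℝ (Fin 3)} {m : EuclideanSpace ℝ (Fin 3)}
    {Y₀ Y₂ : ℝ} (hY₂ : 0 ≤ Y₂) (ha : ∀ p ∈ Sites₀ t A, ‖z p - m - b p‖ ≤ Y₀)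
    (hb : Summable fun p : Sites₀ t A => ‖b p‖ ^ 2) (hb2 : ∑' p : Sites₀ t A, ‖b p‖ ^ 2 ≤ Y₂ ^ 2) :
    ∀ q ∈ Sites₀ t A, ‖z q - m‖ ≤ Y₀ + Y₂ := fun q hq =>
  (norm_sub_le_of_decomp (ha q hq)).trans (add_le_add le_rfl (norm_le_of_tsum_sq_le hY₂ hb hb2 ⟨q, hq⟩))

/-! ## The generic far-sum bound -/

/-- **The generic far-sum bound**: for a site `y ∈ B_{R/2}(c)` and operators `Φ_q` with
`‖Φ_q‖ ≤ CK·dist(q,y)^{-(n+4)}` on the sites outside `B_{4R/5}(c)`,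
`‖Σ'_{q ∉ B_{4R/5}} Φ_q (z q − m)‖² ≤ 2CK²(T₁² Y₀² + T₂ Y₂²)` with the far-field sums `T₁` (exponent `n+4`) and `T₂`
(exponent `2n+8`) over the sites at distance `≥ 3R/10`. [folklore] -/
theorem norm_farSum_sq_le (hA : Adm₀ A) (hI : Inner₀ t A)
    {z b : EuclideanSpace ℝ (Fin 3) → EuclideanSpace ℝ (Fin 3)} {c m : EuclideanSpace ℝ (Fin 3)} {R Y₀ Y₂ : ℝ}
    (hR : 16 ≤ R) (hY₀ : 0 ≤ Y₀) (hY₂ : 0 ≤ Y₂) (ha : ∀ p ∈ Sites₀ t A, ‖z p - m - b p‖ ≤ Y₀)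
    (hb : Summable fun p : Sites₀ t A => ‖b p‖ ^ 2) (hb2 : ∑' p : Sites₀ t A, ‖b p‖ ^ 2 ≤ Y₂ ^ 2)
    {y : EuclideanSpace ℝ (Fin 3)} (hyc : dist y c ≤ R / 2)
    {Φ : Sites₀ t A → (EuclideanSpace ℝ (Fin 3) →L[ℝ] EuclideanSpace ℝ (Fin 3))} {n : ℕ} {CK : ℝ} (hCK : 0 ≤ CK)
    (hΦ : ∀ q : Sites₀ t A, ¬ dist (q : EuclideanSpace ℝ (Fin 3)) c ≤ 4 * R / 5 →
      ‖Φ q‖ ≤ CK * (dist (q : EuclideanSpace ℝ (Fin 3)) y)⁻¹ ^ (n + 4)) :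
    ‖∑' q : Sites₀ t A, (if dist (q : EuclideanSpace ℝ (Fin 3)) c ≤ 4 * R / 5 then (0 : EuclideanSpace ℝ (Fin 3))
        else Φ q (z q - m))‖ ^ 2 ≤
      2 * CK ^ 2 * (1024 / ((23 / 25 : ℝ) ^ 3 * (3 * R / 10) ^ (n + 1))) ^ 2 * Y₀ ^ 2 +
        2 * CK ^ 2 * (1024 / ((23 / 25 : ℝ) ^ 3 * (3 * R / 10) ^ (2 * n + 5))) * Y₂ ^ 2 := by
  have hR3 : (23 / 25 : ℝ) ≤ 3 * R / 10 := by linarith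
  -- the majorant `w q = CK · a q · (Y₀ + ‖b q‖)`
  set a : Sites₀ t A → ℝ := fun q => if 3 * R / 10 ≤ dist (q : EuclideanSpace ℝ (Fin 3)) y then
    (dist (q : EuclideanSpace ℝ (Fin 3)) y)⁻¹ ^ (n + 1 + 3) else 0 with ha_def
  have ha0 : ∀ q, 0 ≤ a q := fun q => by simp only [ha_def]; split_ifs <;> positivity
  have haS : Summable a := summable_far hA hI y hR3 (by omega)
  have haT : ∑' q, a q ≤ 1024 / ((23 / 25 : ℝ) ^ 3 * (3 * R / 10) ^ (n + 1)) := tsum_far_le hA hI y hR3 (by omega)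
  have ha2 : ∀ q, a q ^ 2 = (if 3 * R / 10 ≤ dist (q : EuclideanSpace ℝ (Fin 3)) y then
      (dist (q : EuclideanSpace ℝ (Fin 3)) y)⁻¹ ^ (2 * n + 5 + 3) else 0) := by
    intro q
    simp only [ha_def]
    split_ifs
    · rw [← pow_mul]; congr 1; omega
    · simp
  have ha2S : Summable fun q => a q ^ 2 := by
    simp only [ha2]; exact summable_far hA hI y hR3 (by omega)
  have ha2T : ∑' q, a q ^ 2 ≤ 1024 / ((23 / 25 : ℝ) ^ 3 * (3 * R / 10) ^ (2 * n + 5)) := by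
    simp only [ha2]; exact tsum_far_le hA hI y hR3 (by omega)
  obtain ⟨habS, habT⟩ := tsum_mul_le_sqrt_mul_sqrt ha0 (fun q => norm_nonneg (b q)) ha2S hb
  -- pointwise domination
  have hpt : ∀ q : Sites₀ t A, ‖(if dist (q : EuclideanSpace ℝ (Fin 3)) c ≤ 4 * R / 5 then
      (0 : EuclideanSpace ℝ (Fin 3)) else Φ q (z q - m))‖ ≤ CK * Y₀ * a q + CK * (a q * ‖b q‖) := by
    intro q
    split_ifs with hq
    · rw [norm_zero]
      have := ha0 q
      have := norm_nonneg (b q)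
      positivity
    · have hfar := dist_far_ge hyc hq
      have haq : a q = (dist (q : EuclideanSpace ℝ (Fin 3)) y)⁻¹ ^ (n + 4) := by
        simp only [ha_def, if_pos hfar]
      have h1 := (Φ q).le_opNorm (z q - m)
      have h2 := norm_sub_le_of_decomp (ha q q.2)
      have h3 := hΦ q hq
      rw [haq]
      have h4 : 0 ≤ (dist (q : EuclideanSpace ℝ (Fin 3)) y)⁻¹ ^ (n + 4) := by positivity
      calc ‖Φ q (z q - m)‖ ≤ ‖Φ q‖ * ‖z q - m‖ := h1
        _ ≤ (CK * (dist (q : EuclideanSpace ℝ (Fin 3)) y)⁻¹ ^ (n + 4)) * (Y₀ + ‖b q‖) :=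
            mul_le_mul h3 h2 (norm_nonneg _) (by positivity)
        _ = _ := by ring
  have hwS : Summable fun q : Sites₀ t A => CK * Y₀ * a q + CK * (a q * ‖b q‖) :=
    ((haS.mul_left (CK * Y₀)).add (habS.mul_left CK))
  have hnS : Summable fun q : Sites₀ t A => ‖(if dist (q : EuclideanSpace ℝ (Fin 3)) c ≤ 4 * R / 5 then
      (0 : EuclideanSpace ℝ (Fin 3)) else Φ q (z q - m))‖ :=
    hwS.of_nonneg_of_le (fun _ => norm_nonneg _) hpt
  have hmain : ‖∑' q : Sites₀ t A, (if dist (q : EuclideanSpace ℝ (Fin 3)) c ≤ 4 * R / 5 then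
      (0 : EuclideanSpace ℝ (Fin 3)) else Φ q (z q - m))‖ ≤
      CK * Y₀ * (1024 / ((23 / 25 : ℝ) ^ 3 * (3 * R / 10) ^ (n + 1))) +
        CK * (Real.sqrt (1024 / ((23 / 25 : ℝ) ^ 3 * (3 * R / 10) ^ (2 * n + 5))) * Y₂) := by
    refine (norm_tsum_le_tsum_norm hnS).trans ((hnS.tsum_le_tsum hpt hwS).trans ?_)
    rw [(haS.mul_left (CK * Y₀)).tsum_add (habS.mul_left CK), tsum_mul_left, tsum_mul_left]
    refine add_le_add (mul_le_mul_of_nonneg_left haT (by positivity)) (mul_le_mul_of_nonneg_left ?_ hCK)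
    refine habT.trans (mul_le_mul (Real.sqrt_le_sqrt ha2T) ?_ (Real.sqrt_nonneg _) (Real.sqrt_nonneg _))
    calc Real.sqrt (∑' q : Sites₀ t A, ‖b q‖ ^ 2) ≤ Real.sqrt (Y₂ ^ 2) := Real.sqrt_le_sqrt hb2
      _ = Y₂ := Real.sqrt_sq hY₂
  have hT20 : 0 ≤ 1024 / ((23 / 25 : ℝ) ^ 3 * (3 * R / 10) ^ (2 * n + 5)) := by
    have : 0 < 3 * R / 10 := by linarith
    positivity
  have hsq := Real.sq_sqrt hT20
  set T₁ := 1024 / ((23 / 25 : ℝ) ^ 3 * (3 * R / 10) ^ (n + 1))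
  set s₂ := Real.sqrt (1024 / ((23 / 25 : ℝ) ^ 3 * (3 * R / 10) ^ (2 * n + 5)))
  have hn0 := norm_nonneg (∑' q : Sites₀ t A, (if dist (q : EuclideanSpace ℝ (Fin 3)) c ≤ 4 * R / 5 then
      (0 : EuclideanSpace ℝ (Fin 3)) else Φ q (z q - m)))
  calc _ ≤ (CK * Y₀ * T₁ + CK * (s₂ * Y₂)) ^ 2 := pow_le_pow_left₀ hn0 hmain 2
    _ ≤ 2 * (CK * Y₀ * T₁) ^ 2 + 2 * (CK * (s₂ * Y₂)) ^ 2 := by nlinarith [sq_nonneg (CK * Y₀ * T₁ - CK * (s₂ * Y₂))]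
    _ = 2 * CK ^ 2 * T₁ ^ 2 * Y₀ ^ 2 + 2 * CK ^ 2 * s₂ ^ 2 * Y₂ ^ 2 := by ring
    _ = _ := by rw [hsq]

/-! ## The three forcing bounds -/

/-- **Level 0**: `‖T(y)‖² ≤ 10¹⁵(Y₀²R⁻¹⁰ + Y₂²R⁻¹³)` for sites `y ∈ B_{R/2}(c)` (`|K(w)| ≤ 38|w|⁻⁸`). [folklore] -/
theorem farField_sq_le₀ (hA : Adm₀ A) (hI : Inner₀ t A)
    {z b : EuclideanSpace ℝ (Fin 3) → EuclideanSpace ℝ (Fin 3)} {c m : EuclideanSpace ℝ (Fin 3)} {R Y₀ Y₂ : ℝ}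
    (hR : 16 ≤ R) (hY₀ : 0 ≤ Y₀) (hY₂ : 0 ≤ Y₂) (ha : ∀ p ∈ Sites₀ t A, ‖z p - m - b p‖ ≤ Y₀)
    (hb : Summable fun p : Sites₀ t A => ‖b p‖ ^ 2) (hb2 : ∑' p : Sites₀ t A, ‖b p‖ ^ 2 ≤ Y₂ ^ 2)
    {y : EuclideanSpace ℝ (Fin 3)} (hyc : dist y c ≤ R / 2) :
    ‖∑' q : Sites₀ t A, (if dist (q : EuclideanSpace ℝ (Fin 3)) c ≤ 4 * R / 5 then (0 : EuclideanSpace ℝ (Fin 3))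
        else forceConst (y - q) (z q - m))‖ ^ 2 ≤
      1000000000000000 * (Y₀ ^ 2 * (R⁻¹) ^ 10 + Y₂ ^ 2 * (R⁻¹) ^ 13) := by
  have hR0 : 0 < R := by linarith
  have h := norm_farSum_sq_le hA hI hR hY₀ hY₂ ha hb hb2 hyc (Φ := fun q => forceConst (y - q)) (n := 4)
    (CK := 38) (by norm_num) (fun q hq => by
      have hfar := dist_far_ge hyc hq
      have h9 : 9 / 10 ≤ ‖y - (q : EuclideanSpace ℝ (Fin 3))‖ := by rw [← dist_eq_norm, dist_comm]; linarith
      have := norm_forceConst_le h9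
      rwa [← dist_eq_norm, dist_comm] at this)
  refine h.trans ?_
  have h1 := far_const_le hR0 (4 + 1) (c := 550000) (by norm_num)
  have h2 := far_const_le hR0 (2 * 4 + 5) (c := 10000000000) (by norm_num)
  have h10 : 0 ≤ 1024 / ((23 / 25 : ℝ) ^ 3 * (3 * R / 10) ^ (4 + 1)) := by positivity
  have h1' := pow_le_pow_left₀ h10 h1 2
  have hu : 0 ≤ (R⁻¹) ^ (4 + 1) := by positivity
  have hu' : 0 ≤ (R⁻¹) ^ (2 * 4 + 5) := by positivity
  have e1 : ((R⁻¹) ^ (4 + 1)) ^ 2 = (R⁻¹) ^ 10 := by rw [← pow_mul]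
  have e2 : (R⁻¹) ^ (2 * 4 + 5) = (R⁻¹) ^ 13 := by norm_num
  rw [mul_pow, e1] at h1'
  rw [e2] at h2
  have hY0' : 0 ≤ Y₀ ^ 2 := sq_nonneg _
  have hY2' : 0 ≤ Y₂ ^ 2 := sq_nonneg _
  have hr10 : 0 ≤ (R⁻¹) ^ 10 := by positivity
  have hr13 : 0 ≤ (R⁻¹) ^ 13 := by positivity
  nlinarith [mul_le_mul_of_nonneg_right h1' hY0', mul_le_mul_of_nonneg_right h2 hY2',
    mul_nonneg hr10 hY0', mul_nonneg hr13 hY2']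

/-- **Level 1**: `‖T(y + Al) − T(y)‖² ≤ 10²⁵(Y₀²R⁻¹² + Y₂²R⁻¹⁵)` for sites `y, y + Al` with `y ∈ B_{R/2}(c)`, `‖Al‖ ≤ 2`,
`R ≥ 64` (first kernel difference `≤ 2·10⁵ r⁻⁹|Al|`). [folklore] -/
theorem farField_sq_le₁ (hA : Adm₀ A) (hI : Inner₀ t A)
    {z b : EuclideanSpace ℝ (Fin 3) → EuclideanSpace ℝ (Fin 3)} {c m : EuclideanSpace ℝ (Fin 3)} {R Y₀ Y₂ : ℝ}
    (hR : 64 ≤ R) (hY₀ : 0 ≤ Y₀) (hY₂ : 0 ≤ Y₂) (ha : ∀ p ∈ Sites₀ t A, ‖z p - m - b p‖ ≤ Y₀)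
    (hb : Summable fun p : Sites₀ t A => ‖b p‖ ^ 2) (hb2 : ∑' p : Sites₀ t A, ‖b p‖ ^ 2 ≤ Y₂ ^ 2)
    {y v : EuclideanSpace ℝ (Fin 3)} (hy : y ∈ Sites₀ t A) (hyv : y + v ∈ Sites₀ t A) (hyc : dist y c ≤ R / 2)
    (hv : ‖v‖ ≤ 2) :
    ‖(∑' q : Sites₀ t A, (if dist (q : EuclideanSpace ℝ (Fin 3)) c ≤ 4 * R / 5 then (0 : EuclideanSpace ℝ (Fin 3))
        else forceConst (y + v - q) (z q - m))) -
      ∑' q : Sites₀ t A, (if dist (q : EuclideanSpace ℝ (Fin 3)) c ≤ 4 * R / 5 then (0 : EuclideanSpace ℝ (Fin 3))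
        else forceConst (y - q) (z q - m))‖ ^ 2 ≤
      10000000000000000000000000 * (Y₀ ^ 2 * (R⁻¹) ^ 12 + Y₂ ^ 2 * (R⁻¹) ^ 15) := by
  have hR0 : 0 < R := by linarith
  have hR16 : 16 ≤ R := by linarith
  rw [farField_diff₁ hA hI (norm_sub_le_Ybar hY₂ ha hb hb2) hy hyv]
  have h := norm_farSum_sq_le hA hI hR16 hY₀ hY₂ ha hb hb2 hyc
    (Φ := fun q => forceConst (y - q + v) - forceConst (y - q)) (n := 5) (CK := 400000) (by norm_num)
    (fun q hq => by
      have hfar := dist_far_ge hyc hq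
      have hd : dist (q : EuclideanSpace ℝ (Fin 3)) y = ‖y - (q : EuclideanSpace ℝ (Fin 3))‖ := by
        rw [dist_comm, dist_eq_norm]
      rw [hd] at hfar
      have h9 : 9 / 10 ≤ ‖y - (q : EuclideanSpace ℝ (Fin 3))‖ := by linarith
      have hv4 : ‖v‖ ≤ ‖y - (q : EuclideanSpace ℝ (Fin 3))‖ / 4 := by linarith
      have h1 := norm_forceConst_diff₁_le h9 hv4
      rw [hd]
      have hi0 : 0 ≤ (‖y - (q : EuclideanSpace ℝ (Fin 3))‖⁻¹) ^ 9 := by positivity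
      calc _ ≤ 200000 * (‖y - (q : EuclideanSpace ℝ (Fin 3))‖⁻¹) ^ 9 * ‖v‖ := h1
        _ ≤ 200000 * (‖y - (q : EuclideanSpace ℝ (Fin 3))‖⁻¹) ^ 9 * 2 := by gcongr
        _ = 400000 * (‖y - (q : EuclideanSpace ℝ (Fin 3))‖⁻¹) ^ (5 + 4) := by ring)
  refine h.trans ?_
  have h1 := far_const_le hR0 (5 + 1) (c := 2000000) (by norm_num)
  have h2 := far_const_le hR0 (2 * 5 + 5) (c := 100000000000) (by norm_num)
  have h10 : 0 ≤ 1024 / ((23 / 25 : ℝ) ^ 3 * (3 * R / 10) ^ (5 + 1)) := by positivity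
  have h1' := pow_le_pow_left₀ h10 h1 2
  have e1 : ((R⁻¹) ^ (5 + 1)) ^ 2 = (R⁻¹) ^ 12 := by rw [← pow_mul]
  have e2 : (R⁻¹) ^ (2 * 5 + 5) = (R⁻¹) ^ 15 := by norm_num
  rw [mul_pow, e1] at h1'
  rw [e2] at h2
  have hY0' : 0 ≤ Y₀ ^ 2 := sq_nonneg _
  have hY2' : 0 ≤ Y₂ ^ 2 := sq_nonneg _
  have hr12 : 0 ≤ (R⁻¹) ^ 12 := by positivity
  have hr15 : 0 ≤ (R⁻¹) ^ 15 := by positivity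
  nlinarith [mul_le_mul_of_nonneg_right h1' hY0', mul_le_mul_of_nonneg_right h2 hY2',
    mul_nonneg hr12 hY0', mul_nonneg hr15 hY2']

/-- **Level 2**: `‖T(y + Av′ + Av) − T(y + Av′) − T(y + Av) + T(y)‖² ≤ 10³¹(Y₀²R⁻¹⁴ + Y₂²R⁻¹⁷)` for sites
`y, y+v, y+v′, y+v′+v` with `y ∈ B_{R/2}(c)`, `‖v‖, ‖v′‖ ≤ 2`, `R ≥ 64` (second kernel difference `≤ 2·10⁷ r⁻¹⁰(|v|+|v′|)²`).
[folklore] -/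
theorem farField_sq_le₂ (hA : Adm₀ A) (hI : Inner₀ t A)
    {z b : EuclideanSpace ℝ (Fin 3) → EuclideanSpace ℝ (Fin 3)} {c m : EuclideanSpace ℝ (Fin 3)} {R Y₀ Y₂ : ℝ}
    (hR : 64 ≤ R) (hY₀ : 0 ≤ Y₀) (hY₂ : 0 ≤ Y₂) (ha : ∀ p ∈ Sites₀ t A, ‖z p - m - b p‖ ≤ Y₀)
    (hb : Summable fun p : Sites₀ t A => ‖b p‖ ^ 2) (hb2 : ∑' p : Sites₀ t A, ‖b p‖ ^ 2 ≤ Y₂ ^ 2)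
    {y v v' : EuclideanSpace ℝ (Fin 3)} (hy : y ∈ Sites₀ t A) (hyv : y + v ∈ Sites₀ t A)
    (hyv' : y + v' ∈ Sites₀ t A) (hyvv : y + v' + v ∈ Sites₀ t A) (hyc : dist y c ≤ R / 2)
    (hv : ‖v‖ ≤ 2) (hv' : ‖v'‖ ≤ 2) :
    ‖(∑' q : Sites₀ t A, (if dist (q : EuclideanSpace ℝ (Fin 3)) c ≤ 4 * R / 5 then (0 : EuclideanSpace ℝ (Fin 3))
        else forceConst (y + v' + v - q) (z q - m))) -
      (∑' q : Sites₀ t A, (if dist (q : EuclideanSpace ℝ (Fin 3)) c ≤ 4 * R / 5 then (0 : EuclideanSpace ℝ (Fin 3))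
        else forceConst (y + v' - q) (z q - m))) -
      (∑' q : Sites₀ t A, (if dist (q : EuclideanSpace ℝ (Fin 3)) c ≤ 4 * R / 5 then (0 : EuclideanSpace ℝ (Fin 3))
        else forceConst (y + v - q) (z q - m))) +
      ∑' q : Sites₀ t A, (if dist (q : EuclideanSpace ℝ (Fin 3)) c ≤ 4 * R / 5 then (0 : EuclideanSpace ℝ (Fin 3))
        else forceConst (y - q) (z q - m))‖ ^ 2 ≤
      10000000000000000000000000000000 * (Y₀ ^ 2 * (R⁻¹) ^ 14 + Y₂ ^ 2 * (R⁻¹) ^ 17) := by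
  have hR0 : 0 < R := by linarith
  have hR16 : 16 ≤ R := by linarith
  rw [farField_diff₂ hA hI (norm_sub_le_Ybar hY₂ ha hb hb2) hy hyv hyv' hyvv]
  have h := norm_farSum_sq_le hA hI hR16 hY₀ hY₂ ha hb hb2 hyc
    (Φ := fun q => forceConst (y - q + v' + v) - forceConst (y - q + v') - forceConst (y - q + v) + forceConst (y - q))
    (n := 6) (CK := 320000000) (by norm_num)
    (fun q hq => by
      have hfar := dist_far_ge hyc hq
      have hd : dist (q : EuclideanSpace ℝ (Fin 3)) y = ‖y - (q : EuclideanSpace ℝ (Fin 3))‖ := by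
        rw [dist_comm, dist_eq_norm]
      rw [hd] at hfar
      have h9 : 1 ≤ ‖y - (q : EuclideanSpace ℝ (Fin 3))‖ := by linarith
      have hv4 : ‖v'‖ + ‖v‖ ≤ ‖y - (q : EuclideanSpace ℝ (Fin 3))‖ / 4 := by linarith
      have h1 := norm_forceConst_diff₂_le h9 hv4
      rw [hd]
      have hi0 : 0 ≤ (‖y - (q : EuclideanSpace ℝ (Fin 3))‖⁻¹) ^ 10 := by positivity
      have hs : (‖v'‖ + ‖v‖) ^ 2 ≤ 16 := by nlinarith [norm_nonneg v, norm_nonneg v']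
      calc _ ≤ 20000000 * (‖y - (q : EuclideanSpace ℝ (Fin 3))‖⁻¹) ^ 10 * (‖v'‖ + ‖v‖) ^ 2 := h1
        _ ≤ 20000000 * (‖y - (q : EuclideanSpace ℝ (Fin 3))‖⁻¹) ^ 10 * 16 := by gcongr
        _ = 320000000 * (‖y - (q : EuclideanSpace ℝ (Fin 3))‖⁻¹) ^ (6 + 4) := by ring)
  refine h.trans ?_
  have h1 := far_const_le hR0 (6 + 1) (c := 6100000) (by norm_num)
  have h2 := far_const_le hR0 (2 * 6 + 5) (c := 1100000000000) (by norm_num)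
  have h10 : 0 ≤ 1024 / ((23 / 25 : ℝ) ^ 3 * (3 * R / 10) ^ (6 + 1)) := by positivity
  have h1' := pow_le_pow_left₀ h10 h1 2
  have e1 : ((R⁻¹) ^ (6 + 1)) ^ 2 = (R⁻¹) ^ 14 := by rw [← pow_mul]
  have e2 : (R⁻¹) ^ (2 * 6 + 5) = (R⁻¹) ^ 17 := by norm_num
  rw [mul_pow, e1] at h1'
  rw [e2] at h2
  have hY0' : 0 ≤ Y₀ ^ 2 := sq_nonneg _
  have hY2' : 0 ≤ Y₂ ^ 2 := sq_nonneg _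
  have hr14 : 0 ≤ (R⁻¹) ^ 14 := by positivity
  have hr17 : 0 ≤ (R⁻¹) ^ 17 := by positivity
  nlinarith [mul_le_mul_of_nonneg_right h1' hY0', mul_le_mul_of_nonneg_right h2 hY2',
    mul_nonneg hr14 hY0', mul_nonneg hr17 hY2']

end Blowdown

/-- Registered carrier of this helper file (crux stmt-AtomisticToContinuum-9332, line `Sketch` v4, stub
`stub_interior`, steps (2)–(3)): the far field `T(y) = Σ'_{q ∉ B_{4R/5}(c)} K(y − q)(z q − m)` of a field with far part
`z − m = a + b`, `|a| ≤ Y₀`, `Σ|b|² ≤ Y₂²`, is small on the sites of `B_{R/2}(c)`: `‖T(y)‖² ≤ 10¹⁵(Y₀²R⁻¹⁰ + Y₂²R⁻¹³)`.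
[folklore] -/
theorem blowdown_forcing : ∀ (t : Fin 2 → (EuclideanSpace ℝ (Fin 3)))
    (A : (EuclideanSpace ℝ (Fin 3)) →L[ℝ] (EuclideanSpace ℝ (Fin 3))), Adm₀ A → Inner₀ t A →
    ∀ (z b : (EuclideanSpace ℝ (Fin 3)) → (EuclideanSpace ℝ (Fin 3))) (c m y : (EuclideanSpace ℝ (Fin 3)))
      (R Y₀ Y₂ : ℝ), 16 ≤ R → 0 ≤ Y₀ → 0 ≤ Y₂ → (∀ p ∈ Sites₀ t A, ‖z p - m - b p‖ ≤ Y₀) →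
      Summable (fun p : Sites₀ t A => ‖b p‖ ^ 2) → (∑' p : Sites₀ t A, ‖b p‖ ^ 2) ≤ Y₂ ^ 2 →
      dist y c ≤ R / 2 →
      ‖∑' q : Sites₀ t A, (if dist (q : (EuclideanSpace ℝ (Fin 3))) c ≤ 4 * R / 5
          then (0 : (EuclideanSpace ℝ (Fin 3))) else forceConst (y - q) (z q - m))‖ ^ 2 ≤
        1000000000000000 * (Y₀ ^ 2 * (R⁻¹) ^ 10 + Y₂ ^ 2 * (R⁻¹) ^ 13) :=
  fun _ _ hA hI _ _ _ _ _ _ _ _ hR hY₀ hY₂ ha hb hb2 hyc => Blowdown.farField_sq_le₀ hA hI hR hY₀ hY₂ ha hb hb2 hyc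

end Summit.AtomisticToContinuum.Crystallization.Theorems.ExcessDecayLiouville

end
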